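import Literature.Probability.RandomPlanarGeometry.SLEKappaRhoChainBounds
import HarnessLib

/-!
# [LSW] Lemma 8.10 for arc `+`-hulls: `h'(W)^N ≤ M ≤ h'(W)^ε` with `ε = min(5/8, α)`, `N = max(5/8, α)`

G. F. Lawler, O. Schramm, W. Werner, *Conformal restriction: the chordal case*, J. Amer. Math.
Soc. **16** (2003) 917–955, arXiv:math/0209343 (**[LSW]**), Lemma 8.10: "There exists `ε > 0`
such that `M_t ≤ h_t'(W_t)^ε` for all `t < T`. In particular, `M_t ≤ 1`." Printed proof: "When
`ρ ≥ 0`, the statement is trivial since `b, c ≥ 0` and `h_t'(W_t)`, `h_t'(O_t)` and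
`(h_t(W_t) − h_t(O_t))/(W_t − O_t)` are all in `[0, 1]`. […] (8.2) […] implies that in the case
where `ρ ∈ [−4/3, 0)` (because then `b ≤ 0` and `c ≤ 0`), `M_t ≤ h_t'(W_t)^{5/8+b+c} = h_t'(W_t)^α
≤ 1`. Now suppose `ρ ∈ (−2, −4/3)` […] (8.4) […] `((5/8) − ε)/(x_s − w_s)² + c/((x_s − w_s)(x_s − o_s))
+ b/(x_s − o_s)² ≥ 0` for some positive `ε = ε(ρ)`. The lemma finally follows."

This file PROVES the lemma for the functional `oneSidedM ρ B o` (`SLEKappaRhoMartingale`) of an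
ARC hull `B ∈ 𝒬₊` and `o ≤ 0` — the slid hull `A_t − W_t` and the point `O_t − W_t` of §8.4 —
with the explicit exponents `ε = min(5/8, α)` and, for the lower bound that the end of the proof
of Thm. 8.4 takes from (8.2), `N = max(5/8, α)`:
`Φ'_B(0)^N ≤ oneSidedM ρ B o ≤ Φ'_B(0)^ε` (`SLEKappaRho.oneSidedM_bounds_of_isArcHull`). Along the
chain `(V, S)` of `B` (`SLEKappaRhoLoewnerRepr`, `SLEKappaRhoChainBounds`): for `ρ ≥ 0` by (8.2)
as printed; for ALL `ρ ∈ (−2, 0)` by the representation (8.4),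
`log M = −2 ∫₀^S ((5/8) X² + c XY + b Y²) ds` with `X = 1/(x_s − w_s) ≥ Y = 1/(x_s − o_s) > 0`, and
the bounds `α X² ≤ (5/8) X² + c XY + b Y² ≤ (5/8) X²` of `SLEKappaRhoMartingaleAlgebra`
(`quadForm_ge`, `quadForm_le`), which give `h'(W)^{5/8} ≤ M ≤ h'(W)^α` (this covers the printed
case `ρ ∈ [−4/3, 0)` as well, where (8.2) alone gives the same upper bound).
-/

noncomputable section

open Set Filter MeasureTheory Metric
open scoped NNReal Topology
open UpperHalfPlane (upperHalfPlaneSet)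

namespace Literature.Probability.RandomPlanarGeometry

namespace SLEKappaRho

variable {B : Set ℂ} {ρ : ℝ}

/-! ### Elementary real-power bookkeeping

For a base `e ∈ (0, 1]` real powers are antitone in the exponent: Mathlib's
`Real.rpow_le_rpow_of_exponent_ge` is used directly below (no local restatement, dedup-00631). -/

/-- A factor `x ∈ [e, 1]` raised to a nonnegative power lies in `[e^p, 1]`. [folklore] -/
theorem rpow_mem_Icc_of_nonneg {e x p : ℝ} (he0 : 0 < e) (hx : x ∈ Icc e 1) (hp : 0 ≤ p) :
    x ^ p ∈ Icc (e ^ p) 1 :=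
  ⟨Real.rpow_le_rpow he0.le hx.1 hp, Real.rpow_le_one (he0.le.trans hx.1) hx.2 hp⟩

/-! ### Lemma 8.10 along the chain of `B` -/

section Chain

variable {V : ℝ≥0 → ℝ} (hV : Continuous V) {S : ℝ≥0} (hB : IsPlusHull B)
  (hhull : Loewner.hull V S = B ∩ upperHalfPlaneSet) (hV0 : 0 < V 0)

include hV hB hhull hV0 in
/-- **The case `ρ ≥ 0` ("trivial since `b, c ≥ 0`" and the factors are in `[h'(W), 1]` by
(8.2)):** `h'(W)^α ≤ M ≤ h'(W)^{5/8}`. [cite: LawlerSchrammWerner2003Restriction, proof of Lemma 8.10 (case ρ ≥ 0) with (8.2)] -/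
theorem oneSidedM_bounds_of_nonneg (hρ : 0 ≤ ρ) {o : ℝ} (ho : o ≤ 0) :
    hullDeriv B ^ sleKappaRhoExponent ρ ≤ oneSidedM ρ B o ∧
      oneSidedM ρ B o ≤ hullDeriv B ^ (5 / 8 : ℝ) := by
  obtain ⟨hd, hR⟩ := factors_mem_Icc hV hB hhull hV0 ho
  have he0 := hullDeriv_pos B
  have he1 := hullDeriv_le_one B
  obtain ⟨hd1, hd2⟩ := rpow_mem_Icc_of_nonneg he0 hd (expB_nonneg hρ)
  obtain ⟨hR1, hR2⟩ := rpow_mem_Icc_of_nonneg he0 hR (expC_nonneg hρ)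
  have h58 : 0 < hullDeriv B ^ (5 / 8 : ℝ) := Real.rpow_pos_of_pos he0 _
  have hd0 : 0 ≤ hullDeriv (translate B o) ^ expB ρ := Real.rpow_nonneg (he0.le.trans hd.1) _
  have hR0 : 0 ≤ hullSlope B o ^ expC ρ := Real.rpow_nonneg (he0.le.trans hR.1) _
  rw [oneSidedM, ← five_eighths_add_expB_add_expC, Real.rpow_add he0, Real.rpow_add he0]
  constructor
  · exact mul_le_mul (mul_le_mul_of_nonneg_left hd1 h58.le) hR1 (Real.rpow_nonneg he0.le _)
      (mul_nonneg h58.le hd0)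
  · calc hullDeriv B ^ (5 / 8 : ℝ) * hullDeriv (translate B o) ^ expB ρ * hullSlope B o ^ expC ρ
        ≤ hullDeriv B ^ (5 / 8 : ℝ) * 1 * 1 :=
          mul_le_mul (mul_le_mul_of_nonneg_left hd2 h58.le) hR2 hR0
            (mul_nonneg h58.le zero_le_one)
      _ = hullDeriv B ^ (5 / 8 : ℝ) := by ring

include hV hB hhull hV0 in
/-- **The representation (8.4) of `log M`** for `o < 0`:
`M = exp ∫₀^S ((5/8) chainRate₀ + b chainRate_o + c crossRate) ds`, i.e.
`M_t = exp ∫₀^S (−2(5/8)/(x_s − w_s)² − 2c/((x_s − w_s)(x_s − o_s)) − 2b/(x_s − o_s)²) ds`.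
[cite: LawlerSchrammWerner2003Restriction, proof of Lemma 8.10, (8.4)] -/
theorem oneSidedM_eq_exp {o : ℝ} (ho : o < 0) :
    oneSidedM ρ B o = Real.exp (∫ s in (0 : ℝ)..S,
      (5 / 8 * chainRate V 0 s + expB ρ * chainRate V o s + expC ρ * crossRate V o s)) := by
  have hT₀ := lt_swallowingTime_of_le_zero hV hB hhull hV0 (le_refl (0 : ℝ))
  have hTo := lt_swallowingTime_of_le_zero hV hB hhull hV0 ho.le
  have h0B : ((0 : ℝ) : ℂ) ∉ B := fun hm ↦ by linarith [hB.2 0 hm]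
  have hoB : (o : ℂ) ∉ B := fun hm ↦ by linarith [hB.2 o hm]
  have he : hullDeriv B = Real.exp (∫ s in (0 : ℝ)..S, chainRate V 0 s) := by
    rw [← translate_zero B]
    exact hullDeriv_translate_eq_exp hV hhull hT₀ hB.1.isBoundedHull h0B
  have hd : hullDeriv (translate B o) = Real.exp (∫ s in (0 : ℝ)..S, chainRate V o s) :=
    hullDeriv_translate_eq_exp hV hhull hTo hB.1.isBoundedHull hoB
  have hR : hullSlope B o = Real.exp (∫ s in (0 : ℝ)..S, crossRate V o s) :=
    hullSlope_eq_exp hV hB hhull hV0 ho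
  have hi₀ := intervalIntegrable_chainRate hV hT₀
  have hio := intervalIntegrable_chainRate hV hTo
  have hic : IntervalIntegrable (crossRate V o) volume 0 S :=
    (continuousOn_crossRate hV hB hhull hV0 ho.le).intervalIntegrable_of_Icc S.coe_nonneg
  rw [oneSidedM, he, hd, hR, ← Real.exp_mul, ← Real.exp_mul, ← Real.exp_mul, ← Real.exp_add,
    ← Real.exp_add, intervalIntegral.integral_add (hi₀.const_mul _ |>.add (hio.const_mul _))
      (hic.const_mul _), intervalIntegral.integral_add (hi₀.const_mul _) (hio.const_mul _),
    intervalIntegral.integral_const_mul, intervalIntegral.integral_const_mul,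
    intervalIntegral.integral_const_mul]
  ring_nf

include hV hB hhull hV0 in
/-- **The pointwise bounds of the integrand of (8.4)** for `ρ ∈ (−2, 0)`, `o < 0`, `s ∈ [0, S]`:
with `X = 1/(V_s − ĝ_s(0)) ≥ Y = 1/(V_s − ĝ_s(o)) > 0` the integrand is
`−2((5/8) X² + c XY + b Y²)`, which lies between `(5/8)·(−2X²)` and `α·(−2X²)`
(`quadForm_le`, `quadForm_ge`). [cite: LawlerSchrammWerner2003Restriction, proof of Lemma 8.10 (positivity of the quadratic form)] -/
theorem integrand_bounds (hρ₁ : -2 < ρ) (hρ₂ : ρ < 0) {o : ℝ} (ho : o < 0) {s : ℝ}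
    (hs : s ∈ Icc (0 : ℝ) S) :
    (5 / 8 : ℝ) * chainRate V 0 s ≤
        5 / 8 * chainRate V 0 s + expB ρ * chainRate V o s + expC ρ * crossRate V o s ∧
      5 / 8 * chainRate V 0 s + expB ρ * chainRate V o s + expC ρ * crossRate V o s ≤
        sleKappaRhoExponent ρ * chainRate V 0 s := by
  have hsS : s.toNNReal ≤ S := Real.toNNReal_le_iff_le_coe.2 hs.2
  set m₀ : ℝ := (Loewner.map V s.toNNReal ((0 : ℝ) : ℂ)).re with hm₀
  set mo : ℝ := (Loewner.map V s.toNNReal o).re with hmo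
  set v : ℝ := V s.toNNReal with hv
  have h₀ : m₀ < v := map_re_lt_driving hV hB hhull hV0 le_rfl hsS
  have ho₀ : mo < m₀ := map_re_lt_map_re hV hB hhull hV0 ho le_rfl hsS
  set X : ℝ := (v - m₀)⁻¹ with hX
  set Y : ℝ := (v - mo)⁻¹ with hY
  have hXpos : 0 < X := inv_pos.2 (by linarith)
  have hYpos : 0 < Y := inv_pos.2 (by linarith)
  have hYX : Y ≤ X := by
    rw [hX, hY]
    exact inv_anti₀ (by linarith) (by linarith)
  have hc0 : chainRate V 0 s = -2 * X ^ 2 := by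
    simp only [chainRate, hX, ← hm₀, ← hv, inv_pow]
    rw [div_eq_mul_inv, show (m₀ - v) ^ 2 = (v - m₀) ^ 2 by ring]
  have hco : chainRate V o s = -2 * Y ^ 2 := by
    simp only [chainRate, hY, ← hmo, ← hv, inv_pow]
    rw [div_eq_mul_inv, show (mo - v) ^ 2 = (v - mo) ^ 2 by ring]
  have hcr : crossRate V o s = -2 * X * Y := by
    simp only [crossRate, hX, hY, ← hm₀, ← hmo, ← hv]
    rw [div_eq_mul_inv, show (m₀ - v) * (mo - v) = (v - m₀) * (v - mo) by ring, mul_inv, mul_assoc]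
  have hge := quadForm_ge hρ₁ hρ₂ hYpos.le hYX
  have hle := quadForm_le hρ₁ hρ₂ hYpos.le hYX
  rw [hc0, hco, hcr]
  constructor <;> nlinarith

include hV hB hhull hV0 in
/-- **The case `ρ ∈ (−2, 0)` by (8.4): `h'(W)^{5/8} ≤ M ≤ h'(W)^α`** (integrate `integrand_bounds`
and exponentiate; `h'(W) = exp ∫₀^S chainRate₀`).
[cite: LawlerSchrammWerner2003Restriction, proof of Lemma 8.10 (cases ρ < 0) with (8.4)] -/
theorem oneSidedM_bounds_of_neg (hρ₁ : -2 < ρ) (hρ₂ : ρ < 0) {o : ℝ} (ho : o < 0) :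
    hullDeriv B ^ (5 / 8 : ℝ) ≤ oneSidedM ρ B o ∧
      oneSidedM ρ B o ≤ hullDeriv B ^ sleKappaRhoExponent ρ := by
  have hT₀ := lt_swallowingTime_of_le_zero hV hB hhull hV0 (le_refl (0 : ℝ))
  have hTo := lt_swallowingTime_of_le_zero hV hB hhull hV0 ho.le
  have h0B : ((0 : ℝ) : ℂ) ∉ B := fun hm ↦ by linarith [hB.2 0 hm]
  have he : hullDeriv B = Real.exp (∫ s in (0 : ℝ)..S, chainRate V 0 s) := by
    rw [← translate_zero B]
    exact hullDeriv_translate_eq_exp hV hhull hT₀ hB.1.isBoundedHull h0B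
  have hi₀ := intervalIntegrable_chainRate hV hT₀
  have hio := intervalIntegrable_chainRate hV hTo
  have hic : IntervalIntegrable (crossRate V o) volume 0 S :=
    (continuousOn_crossRate hV hB hhull hV0 ho.le).intervalIntegrable_of_Icc S.coe_nonneg
  have hif : IntervalIntegrable
      (fun s ↦ 5 / 8 * chainRate V 0 s + expB ρ * chainRate V o s + expC ρ * crossRate V o s)
      volume 0 S :=
    ((hi₀.const_mul _).add (hio.const_mul _)).add (hic.const_mul _)
  rw [oneSidedM_eq_exp hV hB hhull hV0 ho, he, ← Real.exp_mul, ← Real.exp_mul,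
    ← intervalIntegral.integral_mul_const, ← intervalIntegral.integral_mul_const,
    Real.exp_le_exp, Real.exp_le_exp]
  constructor
  · refine intervalIntegral.integral_mono_on S.coe_nonneg (hi₀.mul_const _) hif fun s hs ↦ ?_
    rw [mul_comm]
    exact (integrand_bounds hV hB hhull hV0 hρ₁ hρ₂ ho hs).1
  · refine intervalIntegral.integral_mono_on S.coe_nonneg hif (hi₀.mul_const _) fun s hs ↦ ?_
    rw [mul_comm (chainRate V 0 s)]
    exact (integrand_bounds hV hB hhull hV0 hρ₁ hρ₂ ho hs).2

include hV hB hhull hV0 in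
/-- **Lemma 8.10 along the chain, all `ρ > −2`, with explicit exponents**: for `o ≤ 0`,
`h'(W)^{max(5/8, α)} ≤ M ≤ h'(W)^{min(5/8, α)}` (at `o = 0`, `M = h'(W)^α`).
[cite: LawlerSchrammWerner2003Restriction, Lemma 8.10 with (8.2)] -/
theorem oneSidedM_bounds_chain (hρ : -2 < ρ) {o : ℝ} (ho : o ≤ 0) :
    hullDeriv B ^ max (5 / 8 : ℝ) (sleKappaRhoExponent ρ) ≤ oneSidedM ρ B o ∧
      oneSidedM ρ B o ≤ hullDeriv B ^ min (5 / 8 : ℝ) (sleKappaRhoExponent ρ) := by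
  have he0 := hullDeriv_pos B
  have he1 := hullDeriv_le_one B
  rcases ho.lt_or_eq with hlt | rfl
  · rcases le_or_gt 0 ρ with hρ0 | hρ0
    · obtain ⟨h1, h2⟩ := oneSidedM_bounds_of_nonneg hV hB hhull hV0 hρ0 ho
      exact ⟨(Real.rpow_le_rpow_of_exponent_ge he0 he1 (le_max_right _ _)).trans h1,
        h2.trans (Real.rpow_le_rpow_of_exponent_ge he0 he1 (min_le_left _ _))⟩
    · obtain ⟨h1, h2⟩ := oneSidedM_bounds_of_neg hV hB hhull hV0 hρ hρ0 hlt
      exact ⟨(Real.rpow_le_rpow_of_exponent_ge he0 he1 (le_max_left _ _)).trans h1,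
        h2.trans (Real.rpow_le_rpow_of_exponent_ge he0 he1 (min_le_right _ _))⟩
  · rw [oneSidedM_zero]
    exact ⟨Real.rpow_le_rpow_of_exponent_ge he0 he1 (le_max_right _ _),
      Real.rpow_le_rpow_of_exponent_ge he0 he1 (min_le_right _ _)⟩

end Chain

/-! ### Lemma 8.10 for arc `+`-hulls -/

/-- The exponents of Lemma 8.10 are positive: `0 < min(5/8, α(ρ))` for `ρ > −2`. [folklore] -/
theorem exponent_min_pos (hρ : -2 < ρ) : 0 < min (5 / 8 : ℝ) (sleKappaRhoExponent ρ) :=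
  lt_min (by norm_num) (sleKappaRhoExponent_pos hρ)

/-- `0 < max(5/8, α(ρ))`. [folklore] -/
theorem exponent_max_pos (ρ : ℝ) : 0 < max (5 / 8 : ℝ) (sleKappaRhoExponent ρ) :=
  lt_max_of_lt_left (by norm_num)

/-- **[LSW] Lemma 8.10 with (8.2) for an arc hull `B ∈ 𝒬₊`** (the slid hull `g_t(A) − W_t` of
§8.4) and a point `o ≤ 0` (`= O_t − W_t`): `Φ'_B(0)^{max(5/8, α)} ≤ M ≤ Φ'_B(0)^{min(5/8, α)}`,
where `M = oneSidedM ρ B o` and `Φ'_B(0) = hullDeriv B = h_t'(W_t)` — along the Loewner chain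
of the boundary arc of `B` (`exists_chain_of_isArcHull`).
[cite: LawlerSchrammWerner2003Restriction, Lemma 8.10 with (8.2)] -/
theorem oneSidedM_bounds_of_isArcHull (hρ : -2 < ρ) (hB : IsArcHull B) (hB' : IsPlusHull B)
    {o : ℝ} (ho : o ≤ 0) :
    hullDeriv B ^ max (5 / 8 : ℝ) (sleKappaRhoExponent ρ) ≤ oneSidedM ρ B o ∧
      oneSidedM ρ B o ≤ hullDeriv B ^ min (5 / 8 : ℝ) (sleKappaRhoExponent ρ) := by
  obtain ⟨V, S, hV, -, hV0, hhull⟩ := exists_chain_of_isArcHull hB hB'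
  exact oneSidedM_bounds_chain hV hB' hhull hV0 hρ ho

end SLEKappaRho

end Literature.Probability.RandomPlanarGeometry

end
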